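import Summits.Schanuel.Schanuel.Theorems.RootDecomp1BExplicitPair01

/-!
# RootDecomp1BExplicitPair — lens 4, generation 44 «EXPLICIT JU PAIR (ρ_J, σ_J) BY A MEASURE-FREE INDEPENDENCE CRITERION» (CLAIM L2220, ACK/CHECKLIST B-g44 L2225, NODE L2248 / REQUEST L2249, writer re-check L2254, critic VERDICT L2251: CLEARED — THEOREM ×1 «measure-free nested-approximation independence criterion + first explicit JU member»; RULE B-R30; lens-4 tally THEOREM ×8 + CELL ×4) — continuation (RootDecomp1BExplicitPair02): §2 the measure-free independence criterion

(lens-4 g44 HOME kernel K = HOME/decomp-schanuel-lens-4/g44/ExplicitPair.lean c215aab4…, 1070 l, import tree `…RootDecomp1BFactDischarge01` ONLY; P ExplicitPairProbe.lean 61d4e775… rc 0, C ExplicitPairCtrl.lean ef32d495… rc 1 = exactly the 12 planted errors. Port by census-1 gen 19 as `RootDecomp1BExplicitPair01`–`04` (after TwoStorey01–04, as sequenced): 01 = K doc + §1 the ONE new estimate «lower bound near a rational» (`shiftCoeff`, `qpow_mul_aeval_eq`, `exists_shiftCoeff_ne_zero`, `abs_shiftCoeff_le`, `lowest_term_dominates`,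 `eval_lower_near_rat`); 02 = §2 THE CRITERION (`NestedLiouville`, `algebraicIndependent_of_nestedLiouville`, sequence form `algebraicIndependent_of_dominated_approx`, the checklist's weighted shape `…_weighted`); 03 = §3 THE EXPLICIT PAIR (`rhoJ`/`sigmaJ` = even/odd sub-series of the tree tower `uTow`, `rhoJ_add_sigmaJ : rhoJ + sigmaJ = rhoU`, `nestedLiouville_rhoJ_sigmaJ`, `algebraicIndependent_rhoJ_sigmaJ`, `dominated_approx_rhoJ_sigmaJ`, `jointlyUltra_rhoJ_sigmaJ`, `JU_rhoJ_sigmaJ : JU rhoJ sigmaJ` against the TREE class, `exists_JU_explicit`); 04 = §4 each coordinate ultra-Liouville (tree `UltraLiouville`) ⟹ storey-two cells at `(1, ρ_J)`, `(1, σ_J)` BY NAME + §5 controls proved (`not_nestedLiouville_self`, `not_nestedLiouville_sq`, `frozen_level_insufficient`).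
PORT EDITS: `import …RootDecomp1BTwoStorey04` added and K's LOCAL COPIES of `UltraLiouville₂`, `JU` (§3.6) and of g43's `not_algebraicIndependent_sq` DELETED — the tree decls of `RootDecomp1BTwoStorey02/04` are used BY NAME (verdict condition); the file-wide linter option dropped; 23 one-line docstrings added to §3 helper lemmas; 8 generic helpers made PRIVATE (dedup-safety: `aeval_ofReal_int` has name-and-statement twins in RadixCell04 / AlgFrame01; `sum_abs_coeff_eq_len`, `mul_pow_le_of_lt_inv_pow`, `lt_two_pow_of_le_nat`, `half_pow_mul_two_lt`, `threshold_mono`, `den_eq_of_odd`, `not_algebraicIndependent_self`) with per-part private copies; `variable {ρ σ : ℝ}` (implicit binders only) kept; graded statements and proofs verbatim. `--supports stmt-Schanuel-24622`; no census credit carried; rung 0 — nothing here proves Schanuel; `KleinPolarSchanuel`, t(1,ρ_J) ≥ 5 NOT derived.)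
-/

noncomputable section

open Complex Filter Polynomial Finset

namespace Summit.Schanuel.Schanuel.Theorems.RootDecomp1BExplicitPair

open Summit.Schanuel.Schanuel.Theorems.RootDecomp1BTwoStorey (UltraLiouville₂ JU not_algebraicIndependent_sq)

open Summit.Schanuel.Schanuel.Theorems.RootDecomp1KHyper (len len_nonneg len_le_of_natDegree_le one_le_len
  abs_coeff_le_len exists_int_relation exists_ball_eval_ne_zero exists_lipschitz_at_root specialise
  aeval_specialise natDegree_specialise_le len_specialise_le transcendental_ofReal_of_liouville)

/-! ## §2  THE MEASURE-FREE INDEPENDENCE CRITERION (nested rational approximations on a common denominator) -/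

section Criterion

/-- `aeval` at a real point of an integer polynomial, read in `ℂ`. -/
private theorem aeval_ofReal_int (p : ℤ[X]) (x : ℝ) : aeval (x : ℂ) p = ((aeval x p : ℝ) : ℂ) := by
  have hx : (x : ℂ) = algebraMap ℝ ℂ x := rfl
  rw [hx, aeval_algebraMap_apply]
  rfl

/-- [class] definition (membership predicate with parameters, NOT a fact; census convention, VERDICT L2251): the hypothesis class of the measure-free criterion `algebraicIndependent_of_nestedLiouville`; explicit member `(rhoJ, sigmaJ)` (`nestedLiouville_rhoJ_sigmaJ`, part 03). **Nested Liouville pairs** `(ρ, σ)`: for every `k` there are a COMMON denominator `q ≥ 2` and integers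
`a, b` with `0 < |ρ − a/q| < q^{-k}` and `0 < |σ − b/q| < |ρ − a/q|^k` — both coordinates are Liouville and
the error of `σ` is dominated by every power of the error of `ρ` AT THE SAME DENOMINATOR. -/
def NestedLiouville (ρ σ : ℝ) : Prop :=
  ∀ k : ℕ, ∃ (q : ℕ) (a b : ℤ), 2 ≤ q ∧ ρ ≠ a / q ∧ σ ≠ b / q ∧
    |ρ - a / q| < 1 / (q : ℝ) ^ k ∧ |σ - b / q| < |ρ - a / q| ^ k

variable {ρ σ : ℝ}

/-- The first coordinate of a nested Liouville pair is Liouville. -/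
theorem NestedLiouville.liouville_left (h : NestedLiouville ρ σ) : Liouville ρ := by
  intro n
  obtain ⟨q, a, b, hq, hρ, -, hlt, -⟩ := h n
  refine ⟨a, q, by exact_mod_cast hq, ?_, ?_⟩
  · simpa only [Int.cast_natCast] using hρ
  · simpa only [Int.cast_natCast] using hlt

/-- The second coordinate of a nested Liouville pair is Liouville. -/
theorem NestedLiouville.liouville_right (h : NestedLiouville ρ σ) : Liouville σ := by
  intro n
  obtain ⟨q, a, b, hq, -, hσ, hlt, hlt'⟩ := h n
  have hq1 : (1 : ℝ) ≤ q := by exact_mod_cast (show 1 ≤ q by omega)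
  have hqn : (1 : ℝ) ≤ (q : ℝ) ^ n := one_le_pow₀ hq1
  have hε1 : |ρ - a / q| ≤ 1 := hlt.le.trans (by rw [div_le_one (by positivity)]; exact hqn)
  have hmain : |σ - b / q| < 1 / (q : ℝ) ^ n := by
    rcases Nat.eq_zero_or_pos n with rfl | hn
    · simpa using hlt'
    · calc |σ - b / q| < |ρ - a / q| ^ n := hlt'
        _ ≤ |ρ - a / q| := pow_le_of_le_one (abs_nonneg _) hε1 hn.ne'
        _ < 1 / (q : ℝ) ^ n := hlt
  refine ⟨b, q, by exact_mod_cast hq, ?_, ?_⟩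
  · simpa only [Int.cast_natCast] using hσ
  · simpa only [Int.cast_natCast] using hmain

/-- bookkeeping: `ε < q^{-k}`, `e + f ≤ k`, `q ≥ 2` give `ε · q^e ≤ 2^{-f}`. -/
private theorem mul_pow_le_of_lt_inv_pow {ε : ℝ} {q : ℕ} (hq : 2 ≤ q) {k e f : ℕ} (hk : e + f ≤ k)
    (hε : ε < 1 / (q : ℝ) ^ k) : ε * (q : ℝ) ^ e ≤ 1 / (2 : ℝ) ^ f := by
  have hq2 : (2 : ℝ) ≤ q := by exact_mod_cast hq
  have hqpos : (0 : ℝ) < q := by linarith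
  have h1 : ε * (q : ℝ) ^ e ≤ 1 / (q : ℝ) ^ k * (q : ℝ) ^ e :=
    mul_le_mul_of_nonneg_right hε.le (by positivity)
  have h2 : 1 / (q : ℝ) ^ k * (q : ℝ) ^ e ≤ 1 / (q : ℝ) ^ f := by
    rw [div_mul_eq_mul_div, one_mul, div_le_div_iff₀ (by positivity) (by positivity), one_mul,
      ← pow_add]
    exact pow_le_pow_right₀ (by linarith) (by omega)
  have h3 : 1 / (q : ℝ) ^ f ≤ 1 / (2 : ℝ) ^ f :=
    one_div_le_one_div_of_le (by positivity) (pow_le_pow_left₀ (by norm_num) hq2 f)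
  exact h1.trans (h2.trans h3)

/-- `n < 2^n` in `ℝ`, in the form `x ≤ n → x < 2^n`. -/
private theorem lt_two_pow_of_le_nat {x : ℝ} {n : ℕ} (h : x ≤ n) : x < (2 : ℝ) ^ n :=
  h.trans_lt (by exact_mod_cast Nat.lt_two_pow_self)

/-- **THE CRITERION (von Neumann / Perron type, measure-free).** A nested Liouville pair is algebraically
independent over `ℚ`.

PROOF.  `ρ` is Liouville, hence transcendental; a dependence gives (`exists_int_relation`) integer
polynomials `G_0, …, G_K`, `G_K ≠ 0`, with `Σ_k G_k(ρ) σ^k = 0`, i.e. `σ` is a root of the non-zero complex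
polynomial `μ(Y) = Σ_k G_k(ρ) Y^k`.  Near `σ`, `μ` has no other root and is Lipschitz
(`exists_ball_eval_ne_zero`, `exists_lipschitz_at_root`).  At a nested approximation `(a/q, b/q)` of order
`k ≫ 1`: the integer polynomial `H = q^K Σ_k b^k q^{K-k} G_k` (`specialise`) is non-zero (`μ(b/q) ≠ 0`),
`|H(ρ)| = q^K |μ(b/q)| ≤ q^K M |σ − b/q| < q^K M ε^k` (`ε = |ρ − a/q| < q^{-k}`), while the lower bound near
the rational point `a/q` (`eval_lower_near_rat`, the smallness condition being `ε · q^{O(1)} ≪ 1`) gives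
`|H(ρ)| ≥ ε^D / 2`.  For `k` large the two bounds clash. -/
theorem algebraicIndependent_of_nestedLiouville (h : NestedLiouville ρ σ) :
    AlgebraicIndependent ℚ ![(ρ : ℂ), (σ : ℂ)] := by
  by_contra hdep
  have hρt : Transcendental ℚ (ρ : ℂ) := transcendental_ofReal_of_liouville h.liouville_left
  obtain ⟨K, G, hGK, hrel⟩ := exists_int_relation hρt hdep
  -- the complex polynomial μ(Y) = Σ_k G_k(ρ) Y^k
  set μ : ℂ[X] := ∑ k : Fin (K + 1), C (aeval (ρ : ℂ) (G k)) * X ^ (k : ℕ) with hμdef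
  have hμeval : ∀ y : ℂ, μ.eval y = ∑ k : Fin (K + 1), aeval (ρ : ℂ) (G k) * y ^ (k : ℕ) := by
    intro y
    simp only [hμdef, eval_finsetSum, eval_mul, eval_C, eval_pow, eval_X]
  have hμcoeff : ∀ k : Fin (K + 1), μ.coeff k = aeval (ρ : ℂ) (G k) := by
    intro k
    simp only [hμdef, finsetSum_coeff, coeff_C_mul, coeff_X_pow]
    rw [Finset.sum_eq_single k]
    · simp
    · intro j _ hjk
      have : (k : ℕ) ≠ (j : ℕ) := fun h => hjk (Fin.ext h).symm
      simp [this]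
    · intro h; exact absurd (Finset.mem_univ k) h
  have hμ0 : μ ≠ 0 := by
    intro h0
    have h1 : μ.coeff (Fin.last K) = 0 := by rw [h0, coeff_zero]
    rw [hμcoeff] at h1
    exact hρt ((IsFractionRing.isAlgebraic_iff ℤ ℚ ℂ).mp ⟨G (Fin.last K), hGK, h1⟩)
  have hroot : μ.eval (σ : ℂ) = 0 := by rw [hμeval]; exact hrel
  obtain ⟨δ₀, hδ₀, hδroot⟩ := exists_ball_eval_ne_zero μ hμ0 σ
  obtain ⟨M, hM, hLip⟩ := exists_lipschitz_at_root μ σ hroot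
  -- sizes of the relation
  set D : ℕ := Finset.univ.sup fun k : Fin (K + 1) => (G k).natDegree with hDdef
  have hD : ∀ k, (G k).natDegree ≤ D := fun k =>
    Finset.le_sup (f := fun k : Fin (K + 1) => (G k).natDegree) (Finset.mem_univ k)
  set Λ : ℤ := ∑ k : Fin (K + 1), ∑ i ∈ Finset.range (D + 1), |(G k).coeff i| with hΛ
  have hΛ0 : 0 ≤ Λ := Finset.sum_nonneg fun _ _ => Finset.sum_nonneg fun _ _ => abs_nonneg _
  have hΛR0 : (0 : ℝ) ≤ (Λ : ℝ) := by exact_mod_cast hΛ0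
  -- the constant of the smallness condition
  set Cst : ℝ := ((D : ℝ) + 1) * (2 * ((|ρ| + 2) * 1)) ^ D * ((|σ| + 2) ^ K * (Λ : ℝ)) with hCst
  have hCst0 : 0 ≤ Cst := by positivity
  -- the order of approximation
  set j : ℕ := ⌈2 * Cst⌉₊ with hj
  set j' : ℕ := ⌈δ₀⁻¹⌉₊ with hj'
  set m₀ : ℕ := ⌈2 * M⌉₊ with hm₀
  set k : ℕ := 1 + 2 * D + K + j + j' + m₀ with hk
  obtain ⟨q, a, b, hq2, hρne, hσne, hε, hδ⟩ := h k
  have hq2R : (2 : ℝ) ≤ q := by exact_mod_cast hq2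
  have hqpos : (0 : ℝ) < q := by linarith
  have hq1R : (1 : ℝ) ≤ q := by linarith
  have hq0 : q ≠ 0 := by omega
  have hqC : (q : ℂ) ≠ 0 := by exact_mod_cast hq0
  -- names for the two errors
  set ε : ℝ := |ρ - a / q| with hεdef
  set δ : ℝ := |σ - b / q| with hδdef
  have hε0 : 0 < ε := abs_pos.mpr (sub_ne_zero.mpr hρne)
  have hδpos : 0 < δ := abs_pos.mpr (sub_ne_zero.mpr hσne)
  have hε1 : ε ≤ 1 := by
    have : ε * (q : ℝ) ^ 0 ≤ 1 / (2 : ℝ) ^ 0 := mul_pow_le_of_lt_inv_pow hq2 (by omega) hε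
    simpa using this
  have hεk1 : ε ^ k ≤ ε := pow_le_of_le_one hε0.le hε1 (by omega)
  have hδ1 : δ ≤ 1 := (hδ.le.trans hεk1).trans hε1
  -- (0) three smallness consequences of ε < q^{-k}
  have hsmallA : ε * (q : ℝ) ^ (1 + 2 * D + K) ≤ 1 / (2 : ℝ) ^ j :=
    mul_pow_le_of_lt_inv_pow hq2 (by omega) hε
  have hsmallB : ε ≤ 1 / (2 : ℝ) ^ j' := by
    have := mul_pow_le_of_lt_inv_pow hq2 (show 0 + j' ≤ k by omega) hε
    simpa using this
  have hsmallC : ε * (q : ℝ) ^ K ≤ 1 / (2 : ℝ) ^ m₀ :=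
    mul_pow_le_of_lt_inv_pow hq2 (by omega) hε
  -- (1) the approximation b/q of σ is in the good ball: μ(b/q) ≠ 0, |μ(b/q)| ≤ M δ
  set r : ℝ := (b : ℝ) / q with hr
  have hrσ : |r - σ| = δ := by rw [hδdef, abs_sub_comm]
  have hrσ1 : |r - σ| ≤ 1 := hrσ ▸ hδ1
  have hδsmall : δ < δ₀ := by
    have h1 : δ ≤ 1 / (2 : ℝ) ^ j' := ((hδ.le.trans hεk1).trans hsmallB)
    have h2 : 1 / (2 : ℝ) ^ j' < δ₀ := by
      rw [div_lt_iff₀ (by positivity)]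
      have h3 : δ₀⁻¹ < (2 : ℝ) ^ j' := lt_two_pow_of_le_nat (Nat.le_ceil _)
      calc (1 : ℝ) = δ₀ * δ₀⁻¹ := by field_simp
        _ < δ₀ * (2 : ℝ) ^ j' := by gcongr
    exact lt_of_le_of_lt h1 h2
  have hrne : r ≠ σ := fun h => hσne (by rw [← h])
  have hμr : μ.eval (r : ℂ) ≠ 0 := hδroot r hrne (hrσ ▸ hδsmall)
  have hμrle : ‖μ.eval (r : ℂ)‖ ≤ M * δ := hrσ ▸ hLip r hrσ1
  -- (2) the integer polynomial H = q^K P(X, b/q), non-zero, of degree ≤ D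
  set H : ℤ[X] := specialise G b q with hH
  have hrC : ((r : ℝ) : ℂ) = (b : ℂ) / (q : ℂ) := by rw [hr]; push_cast; rfl
  have hHe : aeval (ρ : ℂ) H = (q : ℂ) ^ K * μ.eval (r : ℂ) := by
    rw [hH, aeval_specialise G b hq0, hμeval, hrC]
  have hH0 : H ≠ 0 := by
    intro h0
    have : (q : ℂ) ^ K * μ.eval (r : ℂ) = 0 := by rw [← hHe, h0, map_zero]
    rcases mul_eq_zero.mp this with h | h
    · exact pow_ne_zero K hqC h
    · exact hμr h
  have hdegH : H.natDegree ≤ D := natDegree_specialise_le G b q hD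
  -- (3) the upper bound  |H(ρ)| ≤ q^K M δ
  have hnormH : ‖aeval (ρ : ℂ) H‖ = |aeval ρ H| := by
    rw [aeval_ofReal_int, Complex.norm_real, Real.norm_eq_abs]
  have hup : |aeval ρ H| ≤ (q : ℝ) ^ K * (M * δ) := by
    rw [← hnormH, hHe, norm_mul, norm_pow, Complex.norm_natCast]
    exact mul_le_mul_of_nonneg_left hμrle (by positivity)
  -- (4) the length of H and the size of a
  have hb_bound : (|b| : ℝ) + q ≤ (|σ| + 2) * q := by
    have h2 : |(b : ℝ) / q| ≤ |σ| + 1 := by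
      calc |(b : ℝ) / q| = |(r - σ) + σ| := by rw [hr]; ring_nf
        _ ≤ |r - σ| + |σ| := abs_add_le _ _
        _ ≤ |σ| + 1 := by linarith
    rw [abs_div, abs_of_pos hqpos, div_le_iff₀ hqpos] at h2
    linarith
  have hlenH : (len H : ℝ) ≤ ((|σ| + 2) * q) ^ K * (Λ : ℝ) := by
    have h1 : ((len H : ℤ) : ℝ) ≤ (((|b| + q) ^ K * Λ : ℤ) : ℝ) := by
      exact_mod_cast len_specialise_le G b q hD
    have h2 : (((|b| + q) ^ K * Λ : ℤ) : ℝ) = ((|b| : ℝ) + q) ^ K * (Λ : ℝ) := by push_cast; ring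
    rw [h2] at h1
    refine h1.trans (mul_le_mul_of_nonneg_right ?_ hΛR0)
    exact pow_le_pow_left₀ (by positivity) hb_bound K
  have ha_bound : max 1 |(a : ℝ)| ≤ (|ρ| + 2) * q := by
    refine max_le (by nlinarith [abs_nonneg ρ]) ?_
    have h2 : |(a : ℝ) / q| ≤ |ρ| + 1 := by
      calc |(a : ℝ) / q| = |ρ - (ρ - a / q)| := by ring_nf
        _ ≤ |ρ| + |ρ - a / q| := abs_sub _ _
        _ ≤ |ρ| + 1 := by linarith
    rw [abs_div, abs_of_pos hqpos, div_le_iff₀ hqpos] at h2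
    linarith
  -- (5) the lower bound near a/q:  ε^D / 2 ≤ |H(ρ)|
  set η : ℝ := (q : ℝ) * ρ - a with hη
  have hηε : |η| = (q : ℝ) * ε := by
    rw [hη, hεdef, ← abs_of_pos hqpos, ← abs_mul, abs_of_pos hqpos]
    congr 1
    field_simp
  have hη1 : |η| ≤ 1 := by
    rw [hηε, mul_comm]
    have := mul_pow_le_of_lt_inv_pow hq2 (show 1 + 0 ≤ k by omega) hε
    simpa using this
  have hx : ((a : ℝ) + η) / q = ρ := by
    rw [hη]
    field_simp
    ring
  have hsmall : |η| * (((D : ℝ) + 1) * (2 * max 1 |(a : ℝ)| * q) ^ D * (len H : ℝ)) ≤ 1 / 2 := by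
    have h1 : ((D : ℝ) + 1) * (2 * max 1 |(a : ℝ)| * q) ^ D * (len H : ℝ)
        ≤ ((D : ℝ) + 1) * (2 * ((|ρ| + 2) * q) * q) ^ D * (((|σ| + 2) * q) ^ K * (Λ : ℝ)) := by
      have hl0 : (0 : ℝ) ≤ (len H : ℝ) := by exact_mod_cast len_nonneg H
      gcongr
    have h2 : ((D : ℝ) + 1) * (2 * ((|ρ| + 2) * q) * q) ^ D * (((|σ| + 2) * q) ^ K * (Λ : ℝ))
        = Cst * (q : ℝ) ^ (2 * D + K) := by
      have e1 : (2 * ((|ρ| + 2) * q) * q : ℝ) ^ D = (2 * ((|ρ| + 2) * 1)) ^ D * ((q : ℝ) ^ 2) ^ D := by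
        rw [← mul_pow]
        congr 1
        ring
      have e2 : ((|σ| + 2) * q : ℝ) ^ K = (|σ| + 2) ^ K * (q : ℝ) ^ K := mul_pow _ _ _
      rw [e1, e2, ← pow_mul, hCst]
      ring
    have h3 : |η| * (Cst * (q : ℝ) ^ (2 * D + K)) = Cst * (ε * (q : ℝ) ^ (1 + 2 * D + K)) := by
      rw [hηε]; ring
    have h4 : Cst * (ε * (q : ℝ) ^ (1 + 2 * D + K)) ≤ Cst * (1 / (2 : ℝ) ^ j) :=
      mul_le_mul_of_nonneg_left hsmallA hCst0
    have h5 : Cst * (1 / (2 : ℝ) ^ j) ≤ 1 / 2 := by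
      rw [mul_one_div, div_le_iff₀ (by positivity)]
      have : 2 * Cst < (2 : ℝ) ^ j := lt_two_pow_of_le_nat (Nat.le_ceil _)
      linarith
    calc |η| * (((D : ℝ) + 1) * (2 * max 1 |(a : ℝ)| * q) ^ D * (len H : ℝ))
        ≤ |η| * (Cst * (q : ℝ) ^ (2 * D + K)) := by
          rw [← h2]; exact mul_le_mul_of_nonneg_left h1 (abs_nonneg _)
      _ ≤ 1 / 2 := by rw [h3]; exact h4.trans h5
  have hlow0 := eval_lower_near_rat hH0 hdegH a hq0 hη1 hsmall
  rw [hx, hηε, mul_pow] at hlow0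
  have hlow : ε ^ D / 2 ≤ |aeval ρ H| := by
    have hqD : (0 : ℝ) < (q : ℝ) ^ D := by positivity
    rw [mul_div_assoc] at hlow0
    exact le_of_mul_le_mul_left hlow0 hqD
  -- (6) the clash:  ε^D/2 ≤ |H(ρ)| ≤ q^K M δ < q^K M ε^k ≤ M ε^D (ε q^K) ≤ M ε^D 2^{-m₀} ≤ ε^D / 2
  have hεkD : ε ^ k ≤ ε ^ D * ε := by
    rw [← pow_succ]
    exact pow_le_pow_of_le_one hε0.le hε1 (by omega)
  have hM2 : M * (1 / (2 : ℝ) ^ m₀) ≤ 1 / 2 := by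
    rw [mul_one_div, div_le_iff₀ (by positivity)]
    have : 2 * M < (2 : ℝ) ^ m₀ := lt_two_pow_of_le_nat (Nat.le_ceil _)
    linarith
  have hεD : 0 < ε ^ D := by positivity
  have hchain : ε ^ D / 2 < ε ^ D / 2 :=
    calc ε ^ D / 2 ≤ |aeval ρ H| := hlow
      _ ≤ (q : ℝ) ^ K * (M * δ) := hup
      _ < (q : ℝ) ^ K * (M * ε ^ k) := by gcongr
      _ ≤ (q : ℝ) ^ K * (M * (ε ^ D * ε)) := by gcongr
      _ = ε ^ D * (M * (ε * (q : ℝ) ^ K)) := by ring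
      _ ≤ ε ^ D * (M * (1 / (2 : ℝ) ^ m₀)) := by gcongr
      _ ≤ ε ^ D * (1 / 2) := by gcongr
      _ = ε ^ D / 2 := by ring
  exact lt_irrefl _ hchain

/-- The criterion in SEQUENCE form (the shape announced in the CLAIM): approximations `a_n/q_n`, `b_n/q_n`
on a common denominator schedule with, for every `k`, eventually `0 < |ρ − a_n/q_n| < q_n^{-k}` and
`0 < |σ − b_n/q_n| < |ρ − a_n/q_n|^k`. -/
theorem algebraicIndependent_of_dominated_approx (a b : ℕ → ℤ) (q : ℕ → ℕ) (hq : ∀ n, 2 ≤ q n)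
    (h : ∀ k : ℕ, ∀ᶠ n in atTop, ρ ≠ a n / q n ∧ σ ≠ b n / q n ∧
      |ρ - a n / q n| < 1 / (q n : ℝ) ^ k ∧ |σ - b n / q n| < |ρ - a n / q n| ^ k) :
    AlgebraicIndependent ℚ ![(ρ : ℂ), (σ : ℂ)] := by
  refine algebraicIndependent_of_nestedLiouville fun k => ?_
  obtain ⟨n, hn⟩ := (h k).exists
  exact ⟨q n, a n, b n, hq n, hn⟩

/-- The criterion in the WEIGHTED sequence shape announced in CLAIM L2220 and printed in CHECKLIST B-g44 (1)
(`1 < q_n`; `0 <` errors; weights `(k+1)·q_n^k`).  It implies the shape above at every `k` from its level `k+1`: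
`ε ≤ 1/((k+2) q^{k+1}) < q^{-k}` and `δ ≤ ε^{k+1}/((k+2) q^{k+1}) ≤ ε^k/((k+2) q^{k+1}) < ε^k`. -/
theorem algebraicIndependent_of_dominated_approx_weighted (a b : ℕ → ℤ) (q : ℕ → ℕ) (hq : ∀ n, 1 < q n)
    (h : ∀ k : ℕ, ∀ᶠ n in atTop, 0 < |ρ - a n / q n| ∧ |ρ - a n / q n| * ((k + 1) * (q n : ℝ) ^ k) ≤ 1 ∧
      0 < |σ - b n / q n| ∧ |σ - b n / q n| * ((k + 1) * (q n : ℝ) ^ k) ≤ |ρ - a n / q n| ^ k) :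
    AlgebraicIndependent ℚ ![(ρ : ℂ), (σ : ℂ)] := by
  refine algebraicIndependent_of_dominated_approx a b q (fun n => hq n) fun k => ?_
  filter_upwards [h (k + 1)] with n hn
  obtain ⟨hε0, hε, hδ0, hδ⟩ := hn
  have hq2 : (2 : ℝ) ≤ q n := by exact_mod_cast hq n
  -- the weight `W = (k+2) q^{k+1}` exceeds `q^k` and `1`
  obtain ⟨W, hW⟩ : ∃ W : ℝ, W = ((k + 1 : ℕ) + 1 : ℝ) * (q n : ℝ) ^ (k + 1) := ⟨_, rfl⟩
  have hkW : ((k + 1 : ℕ) + 1 : ℝ) * (q n : ℝ) ^ (k + 1) = W := hW.symm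
  rw [hkW] at hε hδ
  have hqk : (0 : ℝ) < (q n : ℝ) ^ k := by positivity
  have hWgt : (q n : ℝ) ^ k < W := by
    rw [hW]
    have h1 : (q n : ℝ) ^ k < (q n : ℝ) ^ (k + 1) := pow_lt_pow_right₀ (by linarith) (by omega)
    have h2 : (q n : ℝ) ^ (k + 1) ≤ ((k + 1 : ℕ) + 1 : ℝ) * (q n : ℝ) ^ (k + 1) :=
      le_mul_of_one_le_left (by positivity) (by push_cast; linarith [(k.cast_nonneg : (0 : ℝ) ≤ k)])
    exact h1.trans_le h2
  have hW1 : (1 : ℝ) < W := (one_le_pow₀ (by linarith : (1 : ℝ) ≤ q n)).trans_lt hWgt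
  have hWpos : (0 : ℝ) < W := by linarith
  have hε1 : |ρ - a n / q n| ≤ 1 :=
    calc |ρ - a n / q n| = |ρ - a n / q n| * 1 := (mul_one _).symm
      _ ≤ |ρ - a n / q n| * W := mul_le_mul_of_nonneg_left hW1.le (abs_nonneg _)
      _ ≤ 1 := hε
  refine ⟨?_, ?_, ?_, ?_⟩
  · intro hρ; rw [hρ, sub_self, abs_zero] at hε0; exact lt_irrefl _ hε0
  · intro hσ; rw [hσ, sub_self, abs_zero] at hδ0; exact lt_irrefl _ hδ0
  · have hεle : |ρ - a n / q n| ≤ 1 / W := by rw [le_div_iff₀ hWpos]; exact hε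
    exact hεle.trans_lt (one_div_lt_one_div_of_lt hqk hWgt)
  · have hpowk : 0 < |ρ - a n / q n| ^ k := pow_pos hε0 k
    have hδle : |σ - b n / q n| ≤ |ρ - a n / q n| ^ (k + 1) / W := by rw [le_div_iff₀ hWpos]; exact hδ
    calc |σ - b n / q n| ≤ |ρ - a n / q n| ^ (k + 1) / W := hδle
      _ ≤ |ρ - a n / q n| ^ k / W := by
          refine div_le_div_of_nonneg_right ?_ hWpos.le
          calc |ρ - a n / q n| ^ (k + 1) = |ρ - a n / q n| ^ k * |ρ - a n / q n| := pow_succ _ _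
            _ ≤ |ρ - a n / q n| ^ k * 1 := mul_le_mul_of_nonneg_left hε1 hpowk.le
            _ = |ρ - a n / q n| ^ k := mul_one _
      _ < |ρ - a n / q n| ^ k := by
          rw [div_lt_iff₀ hWpos]
          exact lt_mul_of_one_lt_right hpowk hW1

end Criterion

end Summit.Schanuel.Schanuel.Theorems.RootDecomp1BExplicitPair

end
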